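import Summits.QuantumFields.YangMills.Theorems.BalabanUVNodesK0Stub1CurlCurlRowAtCubeDomains
import Summits.QuantumFields.YangMills.Theorems.BalabanUVNodesK0Stub1StraightQTransposeLetter
import Summits.QuantumFields.YangMills.Theorems.BalabanUVNodesN07Letters10OfWeightedRowsNearTop
import HarnessLib

/-!
# N07 [B11] ∕ K0⁷ stub 1 chart lane — **THE OUTWARD MEET EDITION, FILE F: THE MULTIPLIER LETTER AND THE `∂*∂`-ROW OF `A₁` ON A WINDOW OF NEAR-TOP CELLS** (n07-e
# `OUTWARD-MEET-EDITION-SPEC.md` (E2), the last input HCHART-MEET imports from the chart lane): k0-s1-w4's `K0Stub1MultiplierLetterP.multiplierLetter_real ∕ _matrix ∕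
# _matrix_of_bodyAt_adm22` ask the fine bond in the TOP region (`w₁(b) = w₃(b) = 1`, `D.InOm k b₋`; the `Q*`-transpose term by UST `abs_QsE_apply_le_of_top`), and p610743's
# `curlCurl_row_of_critical128_(model_)mat` asks `w₃ = 1` on the window; at an OUTWARD boundary datum of the S6 head the print box over print's (150) family `D″` carries cells of
# level `k − 1` ([15] p.301 «□′_k^{(k−1)}»).  This file re-derives both one level down: the (152) weights are `≥ L^{−m}` there (n07-w4 p615261 `pow_inv_le_levWeightP_of_inOm`), the
# `Q*`-transpose is k0-s1-w4's own level-generic `abs_QsE_apply_le_of_inOm` at `j₀ = k − 1` (two levels see `b`: weight `L^d + 1` instead of `1`), and the curl-curl row takes a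
# LOWER BOUND `θ ≤ w₃` on the window (bound `(θ⁻¹ + B_𝔐)·C₄ρ²`)

Cell `pub-ymgap`, width seat `pub-ymgap-dag-n07-w4` g5 (S6 HEAD; (E2) OFFER ∕ conditional CLAIM-3, cell bus I.41203).  `--kind proof --supports stmt-QuantumFields-20541 --as helper`
(K0⁷: editions of k0-s1-w1∕w4's 20541-keyed files — n07-e's word I.41213, KEY MAP content rule); count-neutral; def-free.  [15] = [Balaban1985Variational]; [B6] = [Balaban1984PropagatorsII]; [B5] = [Balaban1984PropagatorsI].

WHAT IS PROVED (sorry-free; no definition; axioms standard; proofs = the parents' with the three top-window steps replaced).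
§1 `sum_range_ite_pred_le` (the two-level sum `Σ_{k−1 ≤ n ≤ k}`) · ★★ `multiplierLetter_real_nearTop` — generic `(P, k, D)`, `1 ≤ k`, base point `D.InOm (k−1) b₋`, (152) weights
   `IsLevWeight`: `|𝔐f(b)| ≤ (L⁴B₀B₃ + (Lᵈ + 1))·C_Q·C_G·β` · ★ `multiplierLetter_matrix_nearTop` (matrix currents) · ★★ `multiplierLetter_matrix_of_bodyAt_adm22_nearTop` (the `H`-rows
   off `BodyAt`, the `Q`-row from `Adm22`, window `Y` over `Ω_{k−1}`: `‖ℳ(b)‖ ≤ (L⁴B₀B₃ + Lᵈ + 1)·L·C_G·β`).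
§2 ★★ `curlCurl_row_of_critical128_model_mat_lb` · ★★ `curlCurl_row_of_critical128_mat_lb` — p610743's model ∕ T4 rows with `hS : ∀ b ∈ S, θ ≤ wt₃ b` (`0 < θ`), bound
   `(θ⁻¹ + B_𝔐)·(C₄·ρ²)`.
HONEST SCOPE.  Count-neutral re-derivations of k0-s1-w4's and k0-s1-w1's landed theorems with weaker window hypotheses (their declarations untouched); `BodyAt`, `Adm22`, the `G_a` band
row, the (128) ∕ (98)-slot ∕ slice hypotheses stay DISPLAYED; nothing of [15]∕[B6] analysis asserted; `stub_prop8StepCoPG13` ∕ K0⁷ ∕ K1⁹ NOT closed; N07 NOT discharged; counts unmoved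
(typed 28∕28 · discharged 5∕27); one finite 𝕋⁴ programme at fixed ε — the route closes the conditional finite-𝕋⁴ rung `BalabanLadder.UV` ONLY; the YM mass gap (Clay) is NOT proved by
any of this.  No `sorry` ∕ `def` ∕ `instance` ∕ `notation`.

RELATED IN THE TREE, NOT DUPLICATED: k0-s1-w4 `K0Stub1MultiplierLetterP` (top-region parents), `K0Stub1StraightQTransposeLetter.abs_QsE_apply_le_of_inOm` (CONSUMED); k0-s1-w1 p610743
`K0Stub1CurlCurlRowAtCubeDomains` (the `w₃ = 1` parents); n07-w4 p615261 (weights near the top).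

References: [15] (128) p. 297, (131)–(133) p. 298, (150)–(153) p. 301, (158) p. 302, (161)–(162) p. 303, (165) p. 304; [B6] (2.3)–(2.4) p. 224, (2.16) p. 225, (2.19)–(2.20)
p. 226, (2.35) p. 228, Cor. 2.8 p. 249; [B5] (1.18) p. 20.
-/

set_option autoImplicit false
noncomputable section
open scoped BigOperators InnerProductSpace Matrix Matrix.Norms.L2Operator

namespace Summit.QuantumFields.YangMills.BalabanUVNodes.N07MultiplierLetterNearTop

open Literature.MathematicalPhysics.QuantumFieldTheory.Balaban1983to89
open Literature.MathematicalPhysics.QuantumFieldTheory.Balaban1983to89.T4Continuum (T4Family)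
open Literature.MathematicalPhysics.QuantumFieldTheory.BalabanImbrieJaffe1984to88.BIJ85AxialPropagator411 (BondSpace)
open B6SectADomainsV1 (Domains)
open B6SectAOperatorsV1 (BondIdx BondIdxSpace QE QsE RE dsE dcE dcsE aE aE_apply)
open B6SectAVectorModelV1 (deltaAE GE EE)
open B6SectA (hOp)
open T4AdjointCovarianceUnitary (lieSU mem_lieSU_iff)
open Summit.QuantumFields.YangMills.Theorems.FlatCubeOpsText (Adm22 distBI)
open Summit.QuantumFields.YangMills.Theorems.FlatOpsLettersAssembly (Qfun)
open Summit.QuantumFields.YangMills.Theorems.K0FlatCubeOpsTextP (IsLevWeight IsFlatH flatH IsFlatGW HSupLetterG HDecayLetterD RowSum162 GtSupLetterG QContrLetter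
  BodyAt levWeight_nonneg)
open Summit.QuantumFields.YangMills.Theorems.K0FlatPortBodyP (qContrLetter_of_adm22)
open Summit.QuantumFields.YangMills.Theorems.K0Stub1Letter165GtLetterAtRecord (reFunctional_kernel)
open Summit.QuantumFields.YangMills.Theorems.HalvingQuarterMatrix (norm_le_of_forall_reFunctional)
open Summit.QuantumFields.YangMills.Theorems.HalvingQuarterCubeSeq (distBI_nonneg)
open Summit.QuantumFields.YangMills.Theorems.HalvingMultiplierLetter (QsE_EE_QE_GE_eq_of_weights)
open Summit.QuantumFields.YangMills.Theorems.K0Stub1MultiplierLetterP (pow_sub_eq_inv rowsSup_real B₀_nonneg_of_hSupLetterG)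
open Summit.QuantumFields.YangMills.Theorems.K0Stub1StraightQTransposeLetter (abs_QsE_apply_le_of_inOm)
open Summit.QuantumFields.YangMills.Theorems.K0Stub1CurlCurlRowOfEq158 (duality_reading_eq_re dcsE_dcE_re_reading_of_solution RE_dsE_re_reading_sub_HV
  eq158_flatOps_matrixFields_inst)
open Summit.QuantumFields.YangMills.Theorems.K0Stub1Letter165OfCriticalFlatOps (pairing_skew_of_traceless pairing_traceless_of_lieSU coe_lieSU_skew coe_lieSU_trace)
open Summit.QuantumFields.YangMills.BalabanUVNodes.N07Letters10OfWeightedRowsNearTop (pow_inv_le_levWeightP_of_inOm)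

variable {N : ℕ}

/-! ## §1  The multiplier letter at a fine bond of level `≥ k − 1` -/

section Generic

variable {P : Params} {k : ℕ} {D : Domains P}

/-- the two-level sum of `abs_QsE_apply_le_of_inOm` at `j₀ = k − 1` (`1 ≤ k`): `Σ_{n ≤ k, k−1 ≤ n} qⁿ·M = q^{k−1}·M + qᵏ·M`. [folklore] -/
theorem sum_range_ite_pred_le (hk1 : 1 ≤ k) (q M : ℝ) :
    ∑ n ∈ Finset.range (k + 1), (if k - 1 ≤ n then q ^ n * M else 0) = q ^ (k - 1) * M + q ^ k * M := by
  obtain ⟨m, rfl⟩ : ∃ m, k = m + 1 := ⟨k - 1, by omega⟩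
  rw [Nat.add_sub_cancel, Finset.sum_range_succ, Finset.sum_range_succ, if_pos (Nat.le_succ m), if_pos le_rfl,
    Finset.sum_eq_zero fun n hn => if_neg (by have := Finset.mem_range.1 hn; omega), zero_add]

/-- ★★ **THE MULTIPLIER LETTER, REAL CURRENTS, AT A FINE BOND OF LEVEL `≥ k − 1`** — k0-s1-w4's `multiplierLetter_real` with the base point only in `Ω_{k−1} ⊇ Ω_k` of the family
(`D.InOm (k−1) b₋`, `1 ≤ k`) and the (152) weights left in place (`IsLevWeight`: `w_m(b) ≥ L^{−m}` there): `|𝔐f(b)| ≤ (L⁴B₀B₃ + (Lᵈ + 1))·C_Q·C_G·β`.  Term 1 (the text's `∂*∂`-row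
of `H` on `X = Q(G_af)`) loses `w₁w₃ ≥ L^{−4}`; term 2 (the transpose `Q*(aX)`) is the level-generic `abs_QsE_apply_le_of_inOm`: the levels `k − 1` and `k` see `b`, each with column
mass `(L^{−d})ⁿ` against the band-weighted datum `|a(c)X(c)| ≤ (Lᵏ)ᵈ·t` (EVERY cell), total `(Lᵈ + 1)·t`.
[cite: Balaban1985Variational, (131)-(133) p.298, (150) p.301, (161)-(162) p.303, (165) p.304; Balaban1984PropagatorsII, (2.3)-(2.4) p.224, (2.16) p.225, (2.20) p.226, (2.35) p.228; Balaban1984PropagatorsI, (1.18) p.20] -/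
theorem multiplierLetter_real_nearTop (hDk : D.k = k) (hk1 : 1 ≤ k) {dBI : PBond P 0 → BondIdx D → ℝ} {w : ℕ → PBond P 0 → ℝ} (hw : IsLevWeight P k D w)
    {H : (BondIdx D → ℝ) →ₗ[ℝ] (PBond P 0 → ℝ)} (hHf : IsFlatH P k D H)
    {δ₀ B₀ B₃ CG CQ : ℝ} (hH : HDecayLetterD P k D dBI w H B₀ δ₀) (h162 : RowSum162 P k D dBI w δ₀ B₃)
    (hδ₀ : 0 ≤ δ₀) (hB₀ : 0 ≤ B₀) (hd : ∀ b c, 0 ≤ dBI b c)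
    {a : BondIdx D → ℝ} (ha : ∀ i, 0 < a i) {G : (PBond P 0 → ℝ) →ₗ[ℝ] (PBond P 0 → ℝ)} (hGW : IsFlatGW P k D ha G)
    (hGsup : GtSupLetterG P k w G CG) (hband : ∀ c : BondIdx D, a c ≤ ((P.L : ℝ) ^ k) ^ (P.d - 1) * (P.L : ℝ) ^ (c.1.1 : ℕ))
    (hQ : QContrLetter P k D w CQ) (hCG : 0 ≤ CG) (hCQ : 0 ≤ CQ)
    (Mop : (PBond P 0 → ℝ) →ₗ[ℝ] (PBond P 0 → ℝ))
    (hMop : ∀ (f : PBond P 0 → ℝ) (b : PBond P 0),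
      Mop f b = QsE D (EE D (c := (P.L : ℝ) ^ k) (pow_ne_zero _ (Nat.cast_ne_zero.2 P.L_pos.ne')) (w := fun _ => (1 : ℝ)) (fun _ => one_pos)
        (QE D (GE D (c := (P.L : ℝ) ^ k) (pow_ne_zero _ (Nat.cast_ne_zero.2 P.L_pos.ne')) (w := fun _ => (1 : ℝ)) (fun _ => one_pos)
          (WithLp.toLp 2 f)))) b)
    {f : PBond P 0 → ℝ} {β : ℝ} (hβ : 0 ≤ β) (hf : ∀ b, w 3 b * |f b| ≤ β)
    {b : PBond P 0} (hb : D.InOm (k - 1) b.src) :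
    |Mop f b| ≤ ((P.L : ℝ) ^ 4 * (B₀ * B₃) + (((P.L : ℝ) ^ P.d) + 1)) * CQ * CG * β := by
  have hc : ((P.L : ℝ) ^ k) ≠ 0 := pow_ne_zero _ (Nat.cast_ne_zero.2 P.L_pos.ne')
  have hL0 : (0 : ℝ) < (P.L : ℝ) := Nat.cast_pos.mpr P.L_pos
  have hL1 : (1 : ℝ) ≤ (P.L : ℝ) := by exact_mod_cast P.L_pos
  set t : ℝ := CQ * CG * β with ht
  have ht0 : 0 ≤ t := by positivity
  -- the multiplier datum `X = Q(G_a f)` and its size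
  set X : BondIdx D → ℝ := Qfun D (G f) with hX
  have hGf := (hGsup f β hβ hf).1
  have hQX := hQ (G f) (CG * β) (by positivity) hGf
  have hXt : ∀ c : BondIdx D, |X c| ≤ t * (P.L : ℝ) ^ (k - (c.1.1 : ℕ)) := by
    intro c
    have hj : (c.1.1 : ℕ) ≤ k := by have := Nat.lt_succ_iff.1 c.1.1.isLt; omega
    have hpos : (0 : ℝ) < (P.L : ℝ) ^ (c.1.1 : ℕ) * ((P.L : ℝ)⁻¹) ^ k := by positivity
    rw [pow_sub_eq_inv hL0 hj, ← div_eq_mul_inv, le_div_iff₀ hpos, mul_comm]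
    have h := hQX c
    rw [ht]
    linarith
  -- `G f` is `G_a f`, `X` is `Q(G_a f)`
  have hGf' : WithLp.toLp 2 (G f) = GE D hc ha (WithLp.toLp 2 f) := by
    ext b'
    exact hGW f b'
  have hXE : QE D (GE D hc ha (WithLp.toLp 2 f)) = WithLp.toLp 2 X := by
    rw [← hGf']
    ext c'
    rfl
  -- `𝔐f = ∂*∂H(X) + Q*(aX)`
  have hdec := QsE_EE_QE_GE_eq_of_weights D hc (fun _ => one_pos) ha (WithLp.toLp 2 f)
  rw [hXE] at hdec
  have hHX : hOp (GE D hc (w := fun _ => (1 : ℝ)) (fun _ => one_pos)) (QsE D) (EE D hc (w := fun _ => (1 : ℝ)) (fun _ => one_pos))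
      (WithLp.toLp 2 X) = WithLp.toLp 2 (H X) := by
    ext b'
    exact (hHf X b').symm
  have hMb : Mop f b = dcsE ((P.L : ℝ) ^ k) (dcE ((P.L : ℝ) ^ k) (WithLp.toLp 2 (H X))) b + QsE D (aE D a (WithLp.toLp 2 X)) b := by
    rw [hMop f b, hdec, hHX, PiLp.add_apply]
  -- term 1: the text's `∂*∂`-row of `H` on the datum `X`, the weights `w₁ ≥ L⁻¹`, `w₃ ≥ L⁻³` stripped at the price `L⁴`
  have hw1 : ((P.L : ℝ) ^ 1)⁻¹ ^ 1 ≤ w 1 b := pow_inv_le_levWeightP_of_inOm hw hk1 hb 1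
  have hw3 : ((P.L : ℝ) ^ 1)⁻¹ ^ 3 ≤ w 3 b := pow_inv_le_levWeightP_of_inOm hw hk1 hb 3
  rw [pow_one] at hw1 hw3
  rw [pow_one] at hw1
  have h1w := (rowsSup_real hH h162 hδ₀ hB₀ ht0 (hd b) (levWeight_nonneg hw 1 b) hXt).2.2.1
  have h1 : |(dcsE ((P.L : ℝ) ^ k) (dcE ((P.L : ℝ) ^ k) (WithLp.toLp 2 (H X)))) b| ≤ (P.L : ℝ) ^ 4 * (B₀ * B₃) * t := by
    set x := |(dcsE ((P.L : ℝ) ^ k) (dcE ((P.L : ℝ) ^ k) (WithLp.toLp 2 (H X)))) b| with hx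
    have hx0 : 0 ≤ x := abs_nonneg _
    have hcL : 0 < ((P.L : ℝ))⁻¹ := inv_pos.mpr hL0
    -- `L⁻⁴·x ≤ w₁·(w₃·x) ≤ B₀B₃t`
    have hlow : ((P.L : ℝ))⁻¹ * ((((P.L : ℝ))⁻¹) ^ 3 * x) ≤ w 1 b * (w 3 b * x) :=
      mul_le_mul hw1 (mul_le_mul_of_nonneg_right hw3 hx0) (by positivity) (levWeight_nonneg hw 1 b)
    have hkey : ((P.L : ℝ))⁻¹ ^ 4 * x ≤ B₀ * B₃ * t := by
      calc ((P.L : ℝ))⁻¹ ^ 4 * x = ((P.L : ℝ))⁻¹ * ((((P.L : ℝ))⁻¹) ^ 3 * x) := by ring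
        _ ≤ w 1 b * (w 3 b * x) := hlow
        _ ≤ B₀ * B₃ * t := h1w
    have hL4 : (0 : ℝ) < (P.L : ℝ) ^ 4 := by positivity
    have e : (P.L : ℝ) ^ 4 * (((P.L : ℝ))⁻¹ ^ 4 * x) = x := by
      rw [← mul_assoc, inv_pow, mul_inv_cancel₀ hL4.ne', one_mul]
    calc x = (P.L : ℝ) ^ 4 * (((P.L : ℝ))⁻¹ ^ 4 * x) := e.symm
      _ ≤ (P.L : ℝ) ^ 4 * (B₀ * B₃ * t) := mul_le_mul_of_nonneg_left hkey hL4.le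
      _ = (P.L : ℝ) ^ 4 * (B₀ * B₃) * t := by ring
  -- term 2: the transpose of the multi-level average against the band-weighted datum; the levels `k − 1` and `k` see `b`
  have hdpow : ((P.L : ℝ) ^ k) ^ (P.d - 1) * (P.L : ℝ) ^ k = ((P.L : ℝ) ^ k) ^ P.d := by
    rw [← pow_succ, Nat.sub_add_cancel P.hd]
  have hωB : ∀ c : BondIdx D, |aE D a (WithLp.toLp 2 X) c| ≤ (fun _ : ℕ => ((P.L : ℝ) ^ k) ^ P.d * t) c.1.1 := by
    intro c
    rw [aE_apply, abs_mul, abs_of_pos (ha c)]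
    have hj : (c.1.1 : ℕ) ≤ k := by have := Nat.lt_succ_iff.1 c.1.1.isLt; omega
    have hXc := hXt c
    have hwc := hband c
    -- `a(c)·|X c| ≤ (Lᵏ)^{d−1}L^{j}·t·L^{k−j} = (Lᵏ)^d·t`
    have hLL : (P.L : ℝ) ^ (c.1.1 : ℕ) * (P.L : ℝ) ^ (k - (c.1.1 : ℕ)) = (P.L : ℝ) ^ k := by rw [← pow_add, Nat.add_sub_cancel' hj]
    calc a c * |(WithLp.toLp 2 X : BondIdxSpace D) c| ≤ (((P.L : ℝ) ^ k) ^ (P.d - 1) * (P.L : ℝ) ^ (c.1.1 : ℕ)) * (t * (P.L : ℝ) ^ (k - (c.1.1 : ℕ))) :=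
          mul_le_mul hwc hXc (abs_nonneg _) (by positivity)
      _ = (((P.L : ℝ) ^ k) ^ (P.d - 1) * ((P.L : ℝ) ^ (c.1.1 : ℕ) * (P.L : ℝ) ^ (k - (c.1.1 : ℕ)))) * t := by ring
      _ = ((P.L : ℝ) ^ k) ^ P.d * t := by rw [hLL, hdpow]
  have hb' : D.InOm (D.k - 1) b.src := by rw [hDk]; exact hb
  have h2 := abs_QsE_apply_le_of_inOm D (aE D a (WithLp.toLp 2 X)) hb' (fun _ => ((P.L : ℝ) ^ k) ^ P.d * t) (fun _ => by positivity) hωB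
  rw [hDk, sum_range_ite_pred_le hk1] at h2
  have h2' : |QsE D (aE D a (WithLp.toLp 2 X)) b| ≤ ((P.L : ℝ) ^ P.d + 1) * t := by
    have hq0 : (0 : ℝ) ≤ ((P.L : ℝ) ^ P.d)⁻¹ := by positivity
    have hq1 : ((P.L : ℝ) ^ P.d)⁻¹ ≤ 1 := inv_le_one_of_one_le₀ (one_le_pow₀ hL1)
    -- `q^{k−1}·(Lᵏ)^d = (L^d)^{k−(k−1)} ≤ … `: evaluate both terms exactly
    have hLd : (0 : ℝ) < (P.L : ℝ) ^ P.d := by positivity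
    have e1 : ((P.L : ℝ) ^ P.d)⁻¹ ^ k * (((P.L : ℝ) ^ k) ^ P.d * t) = t := by
      rw [← pow_mul, mul_comm k P.d, pow_mul, inv_pow, ← mul_assoc, inv_mul_cancel₀ (pow_ne_zero _ hLd.ne'), one_mul]
    have e2 : ((P.L : ℝ) ^ P.d)⁻¹ ^ (k - 1) * (((P.L : ℝ) ^ k) ^ P.d * t) = (P.L : ℝ) ^ P.d * t := by
      have hsplit : (P.L : ℝ) ^ P.d * ((P.L : ℝ) ^ P.d)⁻¹ ^ k = ((P.L : ℝ) ^ P.d)⁻¹ ^ (k - 1) := by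
        obtain ⟨m, rfl⟩ : ∃ m, k = m + 1 := ⟨k - 1, by omega⟩
        rw [Nat.add_sub_cancel, pow_succ, mul_left_comm, mul_inv_cancel₀ hLd.ne', mul_one]
      rw [← hsplit, mul_assoc, e1]
    calc |QsE D (aE D a (WithLp.toLp 2 X)) b|
        ≤ ((P.L : ℝ) ^ P.d)⁻¹ ^ (k - 1) * (((P.L : ℝ) ^ k) ^ P.d * t) + ((P.L : ℝ) ^ P.d)⁻¹ ^ k * (((P.L : ℝ) ^ k) ^ P.d * t) := h2
      _ = ((P.L : ℝ) ^ P.d + 1) * t := by rw [e1, e2]; ring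
  -- assemble
  rw [hMb]
  calc |dcsE ((P.L : ℝ) ^ k) (dcE ((P.L : ℝ) ^ k) (WithLp.toLp 2 (H X))) b + QsE D (aE D a (WithLp.toLp 2 X)) b|
      ≤ |dcsE ((P.L : ℝ) ^ k) (dcE ((P.L : ℝ) ^ k) (WithLp.toLp 2 (H X))) b| + |QsE D (aE D a (WithLp.toLp 2 X)) b| := abs_add_le _ _
    _ ≤ (P.L : ℝ) ^ 4 * (B₀ * B₃) * t + ((P.L : ℝ) ^ P.d + 1) * t := add_le_add h1 h2'
    _ = ((P.L : ℝ) ^ 4 * (B₀ * B₃) + (((P.L : ℝ) ^ P.d) + 1)) * CQ * CG * β := by rw [ht]; ring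

/-- ★ **THE MULTIPLIER LETTER FOR `M_N(ℂ)`-VALUED CURRENTS AT A FINE BOND OF LEVEL `≥ k − 1`** (k0-s1-w4's `multiplierLetter_matrix` one level down; device: norm-dominated real
readings commute with the kernel extension). [cite: Balaban1985Variational, (131)-(133) p.298, (150) p.301, (165) p.304] -/
theorem multiplierLetter_matrix_nearTop [DecidableEq (PBond P 0)] (hDk : D.k = k) (hk1 : 1 ≤ k) {dBI : PBond P 0 → BondIdx D → ℝ} {w : ℕ → PBond P 0 → ℝ}
    (hw : IsLevWeight P k D w)
    {H : (BondIdx D → ℝ) →ₗ[ℝ] (PBond P 0 → ℝ)} (hHf : IsFlatH P k D H)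
    {δ₀ B₀ B₃ CG CQ : ℝ} (hH : HDecayLetterD P k D dBI w H B₀ δ₀) (h162 : RowSum162 P k D dBI w δ₀ B₃)
    (hδ₀ : 0 ≤ δ₀) (hB₀ : 0 ≤ B₀) (hB₃ : 0 ≤ B₃) (hd : ∀ b c, 0 ≤ dBI b c)
    {a : BondIdx D → ℝ} (ha : ∀ i, 0 < a i) {G : (PBond P 0 → ℝ) →ₗ[ℝ] (PBond P 0 → ℝ)} (hGW : IsFlatGW P k D ha G)
    (hGsup : GtSupLetterG P k w G CG) (hband : ∀ c : BondIdx D, a c ≤ ((P.L : ℝ) ^ k) ^ (P.d - 1) * (P.L : ℝ) ^ (c.1.1 : ℕ))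
    (hQ : QContrLetter P k D w CQ) (hCG : 0 ≤ CG) (hCQ : 0 ≤ CQ)
    (Mop : (PBond P 0 → ℝ) →ₗ[ℝ] (PBond P 0 → ℝ))
    (hMop : ∀ (f : PBond P 0 → ℝ) (b : PBond P 0),
      Mop f b = QsE D (EE D (c := (P.L : ℝ) ^ k) (pow_ne_zero _ (Nat.cast_ne_zero.2 P.L_pos.ne')) (w := fun _ => (1 : ℝ)) (fun _ => one_pos)
        (QE D (GE D (c := (P.L : ℝ) ^ k) (pow_ne_zero _ (Nat.cast_ne_zero.2 P.L_pos.ne')) (w := fun _ => (1 : ℝ)) (fun _ => one_pos)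
          (WithLp.toLp 2 f)))) b)
    {f ℳ : PBond P 0 → Matrix (Fin N) (Fin N) ℂ} {β : ℝ} (hβ : 0 ≤ β) (hf : ∀ b, w 3 b * ‖f b‖ ≤ β)
    (hℳ : ∀ b, ℳ b = ∑ b', Mop (Pi.single b' 1) b • f b')
    {b : PBond P 0} (hb : D.InOm (k - 1) b.src) :
    ‖ℳ b‖ ≤ ((P.L : ℝ) ^ 4 * (B₀ * B₃) + (((P.L : ℝ) ^ P.d) + 1)) * CQ * CG * β := by
  have hq : 0 ≤ ((P.L : ℝ) ^ 4 * (B₀ * B₃) + (((P.L : ℝ) ^ P.d) + 1)) * CQ * CG * β := by positivity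
  refine norm_le_of_forall_reFunctional (ℳ b) hq fun fd u r hg => ?_
  have hker : r * (u * fd (ℳ b)).re = Mop (fun i => r * (u * fd (f i)).re) b := reFunctional_kernel Mop hℳ fd u r b
  have hf' : ∀ b', w 3 b' * |(fun i => r * (u * fd (f i)).re) b'| ≤ β :=
    fun b' => (mul_le_mul_of_nonneg_left (hg (f b')) (levWeight_nonneg hw 3 b')).trans (hf b')
  have hreal : |Mop (fun i => r * (u * fd (f i)).re) b| ≤ ((P.L : ℝ) ^ 4 * (B₀ * B₃) + (((P.L : ℝ) ^ P.d) + 1)) * CQ * CG * β :=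
    multiplierLetter_real_nearTop hDk hk1 hw hHf hH h162 hδ₀ hB₀ hd ha hGW hGsup hband hQ hCG hCQ Mop hMop hβ hf' hb
  rw [hker]
  exact le_trans (le_abs_self (Mop (fun i => r * (u * fd (f i)).re) b)) hreal

/-- ★★ **THE MULTIPLIER LETTER WITH THE `H`-ROWS READ OFF `BodyAt`, WINDOW OVER `Ω_{k−1}`** (k0-s1-w4's `multiplierLetter_matrix_of_bodyAt_adm22` one level down): `BodyAt P k D w B₀ δ₀ B₃`
(`δ₀, B₃ ≥ 0`), `Adm22 D R M`, `2L ≤ R·M`, the (152) weights, a `G_a` band sup row, `1 ≤ k`, a window `Y` with `D.InOm (k−1) x` on it, a matrix current `w₃‖f‖ ≤ β`: at every bond of the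
window `‖ℳ(b)‖ ≤ (L⁴B₀B₃ + Lᵈ + 1)·L·C_G·β`. [cite: Balaban1985Variational, (131)-(133) p.298, (150) p.301, (161)-(163) p.303, (165) p.304; Balaban1984PropagatorsII, (2.1)-(2.2) p.224, Cor. 2.8 (2.150)-(2.151) p.249] -/
theorem multiplierLetter_matrix_of_bodyAt_adm22_nearTop [DecidableEq (PBond P 0)] (hDk : D.k = k) (hk1 : 1 ≤ k) {w : ℕ → PBond P 0 → ℝ} (hw : IsLevWeight P k D w)
    {B₀ δ₀ B₃ : ℝ} (hBody : BodyAt P k D w B₀ δ₀ B₃) (hδ₀ : 0 ≤ δ₀) (hB₃ : 0 ≤ B₃)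
    {R M : ℕ} (hAdm : Adm22 D R M) (hRM : 2 * P.L ≤ R * M)
    {a : BondIdx D → ℝ} (ha : ∀ i, 0 < a i) {G : (PBond P 0 → ℝ) →ₗ[ℝ] (PBond P 0 → ℝ)} (hGW : IsFlatGW P k D ha G) {CG : ℝ} (hCG : 0 ≤ CG)
    (hGsup : GtSupLetterG P k w G CG) (hband : ∀ c : BondIdx D, a c ≤ ((P.L : ℝ) ^ k) ^ (P.d - 1) * (P.L : ℝ) ^ (c.1.1 : ℕ))
    (Mop : (PBond P 0 → ℝ) →ₗ[ℝ] (PBond P 0 → ℝ))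
    (hMop : ∀ (f : PBond P 0 → ℝ) (b : PBond P 0),
      Mop f b = QsE D (EE D (c := (P.L : ℝ) ^ k) (pow_ne_zero _ (Nat.cast_ne_zero.2 P.L_pos.ne')) (w := fun _ => (1 : ℝ)) (fun _ => one_pos)
        (QE D (GE D (c := (P.L : ℝ) ^ k) (pow_ne_zero _ (Nat.cast_ne_zero.2 P.L_pos.ne')) (w := fun _ => (1 : ℝ)) (fun _ => one_pos)
          (WithLp.toLp 2 f)))) b)
    {Y : Set (Site P 0)} (hY : ∀ x ∈ Y, D.InOm (k - 1) x)
    {f ℳ : PBond P 0 → Matrix (Fin N) (Fin N) ℂ} {β : ℝ} (hβ : 0 ≤ β) (hf : ∀ b, w 3 b * ‖f b‖ ≤ β)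
    (hℳ : ∀ b, ℳ b = ∑ b', Mop (Pi.single b' 1) b • f b') (b : PBond P 0) (hb : b.src ∈ Y) :
    ‖ℳ b‖ ≤ ((P.L : ℝ) ^ 4 * (B₀ * B₃) + (((P.L : ℝ) ^ P.d) + 1)) * (P.L : ℝ) * CG * β := by
  obtain ⟨H, -, hHf, -, hHsup, -, -, dBI, hdist, h162, hHdec⟩ := hBody
  have hB₀ : 0 ≤ B₀ := B₀_nonneg_of_hSupLetterG hHsup
  have hd : ∀ b c, 0 ≤ dBI b c := fun b c => (distBI_nonneg D b c).trans (hdist b c)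
  have hQ : QContrLetter P k D w (P.L : ℝ) := qContrLetter_of_adm22 hDk hAdm hRM w hw
  exact multiplierLetter_matrix_nearTop hDk hk1 hw hHf hHdec h162 hδ₀ hB₀ hB₃ hd ha hGW hGsup hband hQ hCG (Nat.cast_nonneg _) Mop hMop hβ hf hℳ (hY b.src hb)

end Generic

/-! ## §2  The `∂*∂`-row of `A₁` with a LOWER BOUND on `w₃` over the window -/

section Model

variable {P : Params} (D : Domains P) {c : ℝ} (hc : c ≠ 0) {w : BondIdx D → ℝ} (hw : ∀ i, 0 < w i)
variable {n : Type*} [Fintype n] [DecidableEq n]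

/-- ★★ **p610743's MODEL ROW WITH `θ ≤ wt₃` ON `S`** (instead of `wt₃ = 1`): (128) + (98)-slot + sizes + slice + `hMmat` on `S` ⇒ `|dcsE c (dcE c (b′ ↦ r·Re(u·f(A₁ b′)))) b| ≤
(θ⁻¹ + B_𝔐)·(C₄·ρ²)` on `S`, `A₁ = A′ − H_V(Q_VA′)` — proof = p610743's with `θ·‖W A′ b‖ ≤ wt₃(b)·‖W A′ b‖ ≤ C₄ρ²` in the one place `wt₃ = 1` was read.
[cite: Balaban1985Variational, (128) p.297, (131)–(133) p.298, (150) p.301, (158) p.302, (165) p.304; Balaban1984PropagatorsII, (2.19) p.226, (2.35) p.228] -/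
theorem curlCurl_row_of_critical128_model_mat_lb {instDE : DecidableEq (PBond P 0)} {instDB : DecidableEq (BondIdx D)}
    (wt : ℕ → PBond P 0 → ℝ) (hw0 : ∀ m b, 0 ≤ wt m b)
    {DV GV MV : (PBond P 0 → Matrix n n ℂ) →ₗ[ℂ] (PBond P 0 → Matrix n n ℂ)} {QV : (PBond P 0 → Matrix n n ℂ) →ₗ[ℂ] (BondIdx D → Matrix n n ℂ)}
    {HV : (BondIdx D → Matrix n n ℂ) →ₗ[ℂ] (PBond P 0 → Matrix n n ℂ)}
    (hDV : ∀ (A : PBond P 0 → Matrix n n ℂ) (b : PBond P 0),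
      DV A b = ∑ j, ((WithLp.ofLp (deltaAE D c w (WithLp.toLp 2 (Pi.single j 1))) b : ℝ) : ℂ) • A j)
    (hGV : ∀ (A : PBond P 0 → Matrix n n ℂ) (b : PBond P 0),
      GV A b = ∑ j, ((WithLp.ofLp ((GE D hc hw - hOp (GE D hc hw) (QsE D) (EE D hc hw) ∘ₗ QE D ∘ₗ GE D hc hw)
        (WithLp.toLp 2 (Pi.single j 1))) b : ℝ) : ℂ) • A j)
    (hQV : ∀ (A : PBond P 0 → Matrix n n ℂ) (t : BondIdx D),
      QV A t = ∑ j, ((WithLp.ofLp (QE D (WithLp.toLp 2 (Pi.single j 1))) t : ℝ) : ℂ) • A j)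
    (hHV : ∀ (B : BondIdx D → Matrix n n ℂ) (b : PBond P 0),
      HV B b = ∑ t, ((WithLp.ofLp (hOp (GE D hc hw) (QsE D) (EE D hc hw) (WithLp.toLp 2 (Pi.single t 1))) b : ℝ) : ℂ) • B t)
    (hMV : ∀ (A : PBond P 0 → Matrix n n ℂ) (b : PBond P 0),
      MV A b = ∑ j, ((WithLp.ofLp ((QsE D ∘ₗ EE D hc hw ∘ₗ QE D ∘ₗ GE D hc hw) (WithLp.toLp 2 (Pi.single j 1))) b : ℝ) : ℂ) • A j)
    (W : (PBond P 0 → Matrix n n ℂ) → (PBond P 0 → Matrix n n ℂ)) {C₄ a₃ ρ ℓ : ℝ}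
    (hWq : ∀ (Y : PBond P 0 → Matrix n n ℂ) (r : ℝ), r < a₃ → (∀ b, wt 1 b * ‖Y b‖ ≤ r) →
      (∀ (b : PBond P 0) (ν : Fin P.d), wt 2 b * ℓ * ‖Y ⟨b.src.shift ν, b.dir⟩ - Y b‖ ≤ r) →
        ∀ b, wt 3 b * ‖W Y b‖ ≤ C₄ * r ^ 2)
    {A' : PBond P 0 → Matrix n n ℂ} (hA : ∀ j, (A' j)ᴴ = -A' j) (hWA : ∀ j, (W A' j)ᴴ = -(W A' j))
    (h128 : ∀ δ : PBond P 0 → Matrix n n ℂ, (∀ j, (δ j)ᴴ = -δ j) → QV δ = 0 →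
      ∑ j, ((δ j)ᴴ * (DV A' j + W A' j)).trace.re = 0)
    (hρ : ρ < a₃) (h1 : ∀ b, wt 1 b * ‖A' b‖ ≤ ρ)
    (h2 : ∀ (b : PBond P 0) (ν : Fin P.d), wt 2 b * ℓ * ‖A' ⟨b.src.shift ν, b.dir⟩ - A' b‖ ≤ ρ)
    (hslice : ∀ φ : Matrix n n ℂ →L[ℂ] ℂ, RE D c (dsE c (WithLp.toLp 2 (fun b => (φ (A' b)).re))) = 0)
    {S : Set (PBond P 0)} {θ : ℝ} (hθ : 0 < θ) (hS : ∀ b ∈ S, θ ≤ wt 3 b) {BM : ℝ}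
    (hMmat : ∀ (g : PBond P 0 → Matrix n n ℂ) (β : ℝ), 0 ≤ β → (∀ b, wt 3 b * ‖g b‖ ≤ β) → ∀ b ∈ S, ‖MV g b‖ ≤ BM * β) :
    ∀ (f : Matrix n n ℂ →L[ℂ] ℂ) (u : ℂ) (r : ℝ), (∀ y : Matrix n n ℂ, |r * (u * f y).re| ≤ ‖y‖) →
      ∀ b ∈ S, |dcsE c (dcE c (WithLp.toLp 2 fun b' => r * (u * f ((A' - HV (QV A')) b')).re)) b| ≤ (θ⁻¹ + BM) * (C₄ * ρ ^ 2) := by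
  intro f u r hf b hb
  have hsol : (A' - HV (QV A')) + GV (W A') = 0 := by
    have h := eq158_flatOps_matrixFields_inst D hc hw hDV hGV hQV hHV W hA hWA h128
    rwa [sub_add_cancel] at h
  have hφ : ∀ y, r * (u * f y).re = (((((r : ℝ) : ℂ) * u) • f) y).re := fun y => duality_reading_eq_re f u r y
  have hφle : ∀ y, |(((((r : ℝ) : ℂ) * u) • f) y).re| ≤ ‖y‖ := fun y => (hφ y) ▸ hf y
  have hsliceA₁ : RE D c (dsE c (WithLp.toLp 2 (fun b => (((((r : ℝ) : ℂ) * u) • f) ((A' - HV (QV A')) b)).re))) = 0 := by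
    rw [RE_dsE_re_reading_sub_HV D hc hw hHV _ A' (QV A')]
    exact hslice _
  have key := dcsE_dcE_re_reading_of_solution D hc hw hGV hMV hsol ((((r : ℝ) : ℂ) * u) • f) hsliceA₁
  have hfun : (fun b' => r * (u * f ((A' - HV (QV A')) b')).re) = fun b' => (((((r : ℝ) : ℂ) * u) • f) ((A' - HV (QV A')) b')).re :=
    funext fun b' => hφ _
  rw [hfun, key, PiLp.add_apply, PiLp.neg_apply, PiLp.toLp_apply, PiLp.toLp_apply]
  have hW : ∀ b', wt 3 b' * ‖W A' b'‖ ≤ C₄ * ρ ^ 2 := hWq A' ρ hρ h1 h2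
  have hC : 0 ≤ C₄ * ρ ^ 2 := (mul_nonneg (hw0 3 b) (norm_nonneg _)).trans (hW b)
  have hwb : |(((((r : ℝ) : ℂ) * u) • f) (W A' b)).re| ≤ θ⁻¹ * (C₄ * ρ ^ 2) := by
    refine (hφle _).trans ?_
    have h := hW b
    -- `θ·‖W A′ b‖ ≤ wt₃(b)·‖W A′ b‖ ≤ C₄ρ²`
    have h' : θ * ‖W A' b‖ ≤ C₄ * ρ ^ 2 := (mul_le_mul_of_nonneg_right (hS b hb) (norm_nonneg _)).trans h
    rw [inv_mul_eq_div, le_div_iff₀ hθ, mul_comm]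
    exact h'
  have hMb : |(((((r : ℝ) : ℂ) * u) • f) (MV (W A') b)).re| ≤ BM * (C₄ * ρ ^ 2) :=
    (hφle _).trans (hMmat (W A') (C₄ * ρ ^ 2) hC hW b hb)
  calc |-(((((r : ℝ) : ℂ) * u) • f) (W A' b)).re + (((((r : ℝ) : ℂ) * u) • f) (MV (W A') b)).re|
      ≤ |-(((((r : ℝ) : ℂ) * u) • f) (W A' b)).re| + |(((((r : ℝ) : ℂ) * u) • f) (MV (W A') b)).re| := abs_add_le _ _
    _ ≤ θ⁻¹ * (C₄ * ρ ^ 2) + BM * (C₄ * ρ ^ 2) := by rw [abs_neg]; exact add_le_add hwb hMb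
    _ = (θ⁻¹ + BM) * (C₄ * ρ ^ 2) := by ring

end Model

/-! ## §3  At NODE 00's fine torus (p604735's block, `𝔰𝔲(N)`-valued (128)), lower bound on `w₃` -/

section Record

/-- ★★ **p610743 §2 WITH `θ ≤ wt₃` ON `S`** — the door for the near-top A₁ line (`S = {b | b₋ ∈ Y}`, `Y` over `Ω_{K−n−1}`, `θ = L⁻³`): bound `(θ⁻¹ + B_𝔐)·(C₄·ρ²)`.
[cite: Balaban1985Variational, (128) p.297, (131)–(133) p.298, (150)–(153) p.301, (158) p.302, (165) p.304; Balaban1984PropagatorsII, (2.19) p.226, (2.35) p.228] -/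
theorem curlCurl_row_of_critical128_mat_lb (F : T4Family) (K k : ℕ) (wt : ℕ → PBond (F.P K) 0 → ℝ) (hw0 : ∀ m b, 0 ≤ wt m b)
    (D : Domains (F.P K))
    {instDE : DecidableEq (PBond (F.P K) 0)} {instDB : DecidableEq (BondIdx D)}
    {DV GV MV : (PBond (F.P K) 0 → Matrix (Fin N) (Fin N) ℂ) →ₗ[ℂ] (PBond (F.P K) 0 → Matrix (Fin N) (Fin N) ℂ)}
    {QV : (PBond (F.P K) 0 → Matrix (Fin N) (Fin N) ℂ) →ₗ[ℂ] (BondIdx D → Matrix (Fin N) (Fin N) ℂ)}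
    {HV : (BondIdx D → Matrix (Fin N) (Fin N) ℂ) →ₗ[ℂ] (PBond (F.P K) 0 → Matrix (Fin N) (Fin N) ℂ)}
    (hDV : ∀ (A : PBond (F.P K) 0 → Matrix (Fin N) (Fin N) ℂ) (b : PBond (F.P K) 0),
      DV A b = ∑ j, ((WithLp.ofLp (deltaAE D ((F.P K).L ^ k : ℝ) (fun _ => (1 : ℝ)) (WithLp.toLp 2 (Pi.single j 1))) b : ℝ) : ℂ) • A j)
    (hGV : ∀ (A : PBond (F.P K) 0 → Matrix (Fin N) (Fin N) ℂ) (b : PBond (F.P K) 0),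
      GV A b = ∑ j, ((WithLp.ofLp ((GE D (c := ((F.P K).L : ℝ) ^ k) (pow_ne_zero _ (Nat.cast_ne_zero.2 (F.P K).L_pos.ne')) (w := fun _ => (1 : ℝ)) (fun _ => one_pos)
        - hOp (GE D (c := ((F.P K).L : ℝ) ^ k) (pow_ne_zero _ (Nat.cast_ne_zero.2 (F.P K).L_pos.ne')) (w := fun _ => (1 : ℝ)) (fun _ => one_pos)) (QsE D)
            (EE D (c := ((F.P K).L : ℝ) ^ k) (pow_ne_zero _ (Nat.cast_ne_zero.2 (F.P K).L_pos.ne')) (w := fun _ => (1 : ℝ)) (fun _ => one_pos))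
          ∘ₗ QE D ∘ₗ GE D (c := ((F.P K).L : ℝ) ^ k) (pow_ne_zero _ (Nat.cast_ne_zero.2 (F.P K).L_pos.ne')) (w := fun _ => (1 : ℝ)) (fun _ => one_pos))
        (WithLp.toLp 2 (Pi.single j 1))) b : ℝ) : ℂ) • A j)
    (hQV : ∀ (A : PBond (F.P K) 0 → Matrix (Fin N) (Fin N) ℂ) (t : BondIdx D),
      QV A t = ∑ j, ((WithLp.ofLp (QE D (WithLp.toLp 2 (Pi.single j 1))) t : ℝ) : ℂ) • A j)
    (hHV : ∀ (B : BondIdx D → Matrix (Fin N) (Fin N) ℂ) (b : PBond (F.P K) 0),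
      HV B b = ∑ t, ((WithLp.ofLp (hOp (GE D (c := ((F.P K).L : ℝ) ^ k) (pow_ne_zero _ (Nat.cast_ne_zero.2 (F.P K).L_pos.ne')) (w := fun _ => (1 : ℝ)) (fun _ => one_pos))
        (QsE D) (EE D (c := ((F.P K).L : ℝ) ^ k) (pow_ne_zero _ (Nat.cast_ne_zero.2 (F.P K).L_pos.ne')) (w := fun _ => (1 : ℝ)) (fun _ => one_pos))
        (WithLp.toLp 2 (Pi.single t 1))) b : ℝ) : ℂ) • B t)
    (hMV : ∀ (A : PBond (F.P K) 0 → Matrix (Fin N) (Fin N) ℂ) (b : PBond (F.P K) 0),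
      MV A b = ∑ j, ((WithLp.ofLp ((QsE D
          ∘ₗ EE D (c := ((F.P K).L : ℝ) ^ k) (pow_ne_zero _ (Nat.cast_ne_zero.2 (F.P K).L_pos.ne')) (w := fun _ => (1 : ℝ)) (fun _ => one_pos)
          ∘ₗ QE D ∘ₗ GE D (c := ((F.P K).L : ℝ) ^ k) (pow_ne_zero _ (Nat.cast_ne_zero.2 (F.P K).L_pos.ne')) (w := fun _ => (1 : ℝ)) (fun _ => one_pos))
        (WithLp.toLp 2 (Pi.single j 1))) b : ℝ) : ℂ) • A j)
    (W : (PBond (F.P K) 0 → Matrix (Fin N) (Fin N) ℂ) → (PBond (F.P K) 0 → Matrix (Fin N) (Fin N) ℂ)) {C₄ a₃ ρ : ℝ}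
    (hWq : ∀ (Y : PBond (F.P K) 0 → Matrix (Fin N) (Fin N) ℂ) (r : ℝ), r < a₃ → (∀ b, wt 1 b * ‖Y b‖ ≤ r) →
      (∀ (b : PBond (F.P K) 0) (ν : Fin 4), wt 2 b * (F.L : ℝ) ^ k * ‖Y ⟨b.src.shift ν, b.dir⟩ - Y b‖ ≤ r) →
        ∀ b, wt 3 b * ‖W Y b‖ ≤ C₄ * r ^ 2)
    (X : PBond (F.P K) 0 → lieSU (Fin N))
    (hWA : ∀ j, (W (fun b => ((X b : lieSU (Fin N)) : Matrix (Fin N) (Fin N) ℂ)) j)ᴴ = -(W (fun b => ((X b : lieSU (Fin N)) : Matrix (Fin N) (Fin N) ℂ)) j))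
    (hWtr : ∀ j, (W (fun b => ((X b : lieSU (Fin N)) : Matrix (Fin N) (Fin N) ℂ)) j).trace = 0)
    (h128 : ∀ δ : PBond (F.P K) 0 → lieSU (Fin N), QV (fun j => ((δ j : lieSU (Fin N)) : Matrix (Fin N) (Fin N) ℂ)) = 0 →
      ∑ j, (((δ j : lieSU (Fin N)) : Matrix (Fin N) (Fin N) ℂ)ᴴ *
        (DV (fun b => ((X b : lieSU (Fin N)) : Matrix (Fin N) (Fin N) ℂ)) j + W (fun b => ((X b : lieSU (Fin N)) : Matrix (Fin N) (Fin N) ℂ)) j)).trace.re = 0)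
    (hρ : ρ < a₃) (h1 : ∀ b, wt 1 b * ‖((X b : lieSU (Fin N)) : Matrix (Fin N) (Fin N) ℂ)‖ ≤ ρ)
    (h2 : ∀ (b : PBond (F.P K) 0) (ν : Fin 4),
      wt 2 b * (F.L : ℝ) ^ k * ‖((X ⟨b.src.shift ν, b.dir⟩ : lieSU (Fin N)) : Matrix (Fin N) (Fin N) ℂ) - ((X b : lieSU (Fin N)) : Matrix (Fin N) (Fin N) ℂ)‖ ≤ ρ)
    (hslice : ∀ φ : Matrix (Fin N) (Fin N) ℂ →L[ℂ] ℂ,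
      RE D (((F.P K).L : ℝ) ^ k) (dsE (((F.P K).L : ℝ) ^ k) (WithLp.toLp 2 (fun b => (φ ((X b : lieSU (Fin N)) : Matrix (Fin N) (Fin N) ℂ)).re))) = 0)
    {S : Set (PBond (F.P K) 0)} {θ : ℝ} (hθ : 0 < θ) (hS : ∀ b ∈ S, θ ≤ wt 3 b) {BM : ℝ}
    (hMmat : ∀ (g : PBond (F.P K) 0 → Matrix (Fin N) (Fin N) ℂ) (β : ℝ), 0 ≤ β → (∀ b, wt 3 b * ‖g b‖ ≤ β) → ∀ b ∈ S, ‖MV g b‖ ≤ BM * β) :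
    ∀ (f : Matrix (Fin N) (Fin N) ℂ →L[ℂ] ℂ) (u : ℂ) (r : ℝ), (∀ y : Matrix (Fin N) (Fin N) ℂ, |r * (u * f y).re| ≤ ‖y‖) →
      ∀ b ∈ S,
        |dcsE (((F.P K).L : ℝ) ^ k) (dcE (((F.P K).L : ℝ) ^ k)
            (WithLp.toLp 2 fun b' => r * (u * f (((fun b => ((X b : lieSU (Fin N)) : Matrix (Fin N) (Fin N) ℂ)) -
              HV (QV fun b => ((X b : lieSU (Fin N)) : Matrix (Fin N) (Fin N) ℂ))) b')).re)) b|
          ≤ (θ⁻¹ + BM) * (C₄ * ρ ^ 2) := by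
  have hc : (((F.P K).L : ℝ)) ^ k ≠ 0 := pow_ne_zero _ (Nat.cast_ne_zero.2 (F.P K).L_pos.ne')
  have h128' : ∀ δ : PBond (F.P K) 0 → Matrix (Fin N) (Fin N) ℂ, (∀ j, (δ j)ᴴ = -δ j) →
      QV δ = 0 → ∑ j, ((δ j)ᴴ * (DV (fun b => ((X b : lieSU (Fin N)) : Matrix (Fin N) (Fin N) ℂ)) j +
        W (fun b => ((X b : lieSU (Fin N)) : Matrix (Fin N) (Fin N) ℂ)) j)).trace.re = 0 := by
    refine pairing_skew_of_traceless
      ((WithLp.linearEquiv 2 ℝ (PBond (F.P K) 0 → ℝ)).toLinearMap ∘ₗ deltaAE D (((F.P K).L : ℝ) ^ k) (fun _ => (1 : ℝ)) ∘ₗ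
        (WithLp.linearEquiv 2 ℝ (PBond (F.P K) 0 → ℝ)).symm.toLinearMap)
      ((WithLp.linearEquiv 2 ℝ (BondIdx D → ℝ)).toLinearMap ∘ₗ QE D ∘ₗ (WithLp.linearEquiv 2 ℝ (PBond (F.P K) 0 → ℝ)).symm.toLinearMap)
      (fun A b => ?_) (fun A t => ?_) (fun j => coe_lieSU_trace (X j)) hWtr (pairing_traceless_of_lieSU h128)
    · simp only [LinearMap.comp_apply, LinearEquiv.coe_coe, WithLp.coe_linearEquiv, WithLp.coe_symm_linearEquiv]; exact hDV A b
    · simp only [LinearMap.comp_apply, LinearEquiv.coe_coe, WithLp.coe_linearEquiv, WithLp.coe_symm_linearEquiv]; exact hQV A t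
  exact curlCurl_row_of_critical128_model_mat_lb D hc (fun _ => one_pos) wt hw0 hDV hGV hQV hHV hMV W hWq (fun j => coe_lieSU_skew (X j)) hWA h128' hρ h1 h2
    hslice hθ hS hMmat

end Record

end Summit.QuantumFields.YangMills.BalabanUVNodes.N07MultiplierLetterNearTop

end
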